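import Summits.QuantumFields.BalabanUV.Beta.CombChartContactFactor
import Summits.QuantumFields.BalabanUV.Beta.RelInvCombShiftedSpread
import Summits.QuantumFields.BalabanUV.Beta.RelInvBorderedHessianStep

/-!
# `BalabanUV.Beta.RelInvUnique` — binder row D1 ∕ (C1): **THE RELATIVE INVERSE IS UNIQUE** (`RelInv A 𝕄 E ∧ RelInv A′ 𝕄 E ⟹ A = A′` for spread kernels), and
# its one consequence for the (I)∕(II)∕L fork of row D1: the rooted block-mean chart `coDressKBmAt ρ_c Lc (KInvStep Lc j)` inverts the (0.4)-SYMMETRISED legged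
# spread `bhKStepSh 3 Lc (Dsh Lc) j` on the comb slice ONLY IF it IS the record's chart `GcombSh Lc j` (row OWNER an2 gen 89; ERRATUM E-AN2-89-2 kernel-checked)

WHAT ([folklore], elementary; no `def`, nothing cited, no `Prop` fact):
* §1 **`relInv_unique`**: for `Spr A`, `Spr A′`, `Spr 𝕄`, `Spr E`, `RelInv A 𝕄 E → RelInv A′ 𝕄 E → A = A′` — both equal `(A∘𝕄)∘A′` (`A′ = E∘A′ = ((A∘𝕄)∘E)∘A′ = (A∘𝕄)∘(E∘A′)`,
  `A = A∘E = A∘((E∘𝕄)∘A′) = ((A∘E)∘𝕄)∘A′`; tame associativity `TameKernelCalculus.comp_assoc_tame`).  So a chart is not a free «gauge» choice: it is THE inverse of the legged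
  bordered step Hessian relative to the slice — determined by the ROWS in the border once the slice is fixed.
* §2 **`coDressKBmAt_eq_GcombSh_of_relInv_sym`**: `RelInv (coDressKBmAt (ctr 4 Lc) Lc (KInvStep Lc j)) (bhKStepSh 3 Lc (Dsh Lc) j) (axEc (ctr 4 Lc) Lc) → coDressKBmAt … = GcombSh Lc j`
  (`ctr 4 Lc = toSite (ctrOff 4 Lc)` by `rfl`, lit `AveragingContoursRooted` L.373 — XREAD-KR's `ARoot Lc j` is this chart)
  (§1 with P2 `RelInvCombShiftedSpread.relInv_coDressKAt_Gsym_bhKStepSh`); and the record's own pairings restated side by side: **`relInv_record_pair`** = P2 (the (0.4) rows' chart is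
  `GcombSh`) and **`relInv_rooted_pair`** = `BorderedHessian.relInv_coDressKBmAt_KInvStep_bhKStepAt` (the rooted rows' chart is the bm chart) — SAME slice `axEc ρ_c`, DIFFERENT borders.
WHY (FINDING AN2-89-1 ∕ E-AN2-89-2, `HOME/b2b-balaban-beta-an2/gen89/REFEREE-TABLE-89.md` v1.2 §1 (e)(f)): the (I)∕(II) fork of `ttrl/requests.jsonl` l.4579's last row was first read as a
«re-chart the literal» choice; by §1–§2 there is no such choice — pairing the (0.4) tables of record (D6) with the bm chart would require the bm chart to invert the (0.4)-bordered
spread, i.e. to BE `GcombSh` (it is not: PRESTAB's Δ_chart, P2's K0–K5); the consistent ports are all-rooted (charter-excluded by RULING R-D1-g25-1 (R3)) and all-(0.4) (the (0.4)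
COMPOSITE chart, absent).  HONEST: two restatements + one four-line algebra lemma + one corollary; nothing of Bałaban's asserted, valued or discharged; the literal of record, ROOT M‴ ∕
P5c ∕ D6, v10 + END v3 + W untouched; 0∕4 row-D1 binders; NOT (C1), NOT (T-ID), NOT D1, NEVER «G-an2-4 closed», NOT BetaPertH, NOT continuum, NOT Clay.
HONEST DEPENDENCY (page 1, mandatory): continuum YM on T⁴ ⇐ BetaPertH ∧ nine spine estimates (0/9 proved); BetaPertH ⇐ (D1) ∧ (D4) ∧ CAP+tail; G-an2-4 gates asym, D1 and NE2/3/4.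
Row D1 ∕ (C1) OWNER an2, gen 89, 2026-08-30.  No existing file touched.
-/

noncomputable section

namespace Summit.QuantumFields.BalabanUV.Beta.RelInvUnique

open Literature.MathematicalPhysics.QuantumFieldTheory.Balaban1983to89
open Literature.MathematicalPhysics.QuantumFieldTheory.Balaban1983to89.Beta
open ExpKernelCalculus (MKer comp)
open AffineAveraging (box toSite)
open AveragingContoursRooted (ctr ctrOff ctrOff_mem_box)
open OneStepResolventKernel (Fib)
open OneStepKernelFamily (KInvStep)
open Summit.QuantumFields.BalabanUV.Beta.TameKernelCalculus
open Summit.QuantumFields.BalabanUV.Beta.ChartConjugationRelative (RelInv spr_comp)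
open Summit.QuantumFields.BalabanUV.Beta.AxialDressingRooted (one_le_of_neZero coDressKAt coDressKBmAt axEc spr_axEc spr_coDressKBmAt)
open Summit.QuantumFields.BalabanUV.Beta.BorderedHessian (bhKStepAt spr_bhKStepAt relInv_coDressKBmAt_KInvStep_bhKStepAt spr_KInvStep)
open Summit.QuantumFields.BalabanUV.Beta.SymmetrisedStepJets (Gsym)
open Summit.QuantumFields.BalabanUV.Beta.SymShiftedSpread (bhKStepSh spr_bhKStepSh)
open Summit.QuantumFields.BalabanUV.Beta.DshAn1 (Dsh spr_Dsh)
open Summit.QuantumFields.BalabanUV.Beta.CombChartStepJets (GcombSh)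
open Summit.QuantumFields.BalabanUV.Beta.CombChartContactFactor (spr_GcombSh)
open Summit.QuantumFields.BalabanUV.Beta.RelInvCombShiftedSpread (relInv_coDressKAt_Gsym_bhKStepSh)

/-! ## §1 Uniqueness of the relative inverse -/

section Unique

variable {D : ℕ} {F : Type*} [Fintype F]

/-- [folklore] **THE RELATIVE INVERSE IS UNIQUE.**  For spread kernels `A`, `A′`, `𝕄`, `E`: `RelInv A 𝕄 E → RelInv A′ 𝕄 E → A = A′`.  Proof: both sides equal `(A∘𝕄)∘A′` —
`A′ = E∘A′ = ((A∘𝕄)∘E)∘A′ = (A∘𝕄)∘(E∘A′) = (A∘𝕄)∘A′` and `A = A∘E = A∘((E∘𝕄)∘A′) = ((A∘E)∘𝕄)∘A′ = (A∘𝕄)∘A′`, re-associating with `comp_assoc_tame`. -/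
theorem relInv_unique {A A' M E : MKer D F} (hA : Spr A) (hA' : Spr A') (hM : Spr M) (hE : Spr E) (h : RelInv A M E) (h' : RelInv A' M E) :
    A = A' := by
  obtain ⟨hEA, hAE, hAME, hEMA⟩ := h
  obtain ⟨hEA', hAE', hAME', hEMA'⟩ := h'
  have tA := hA.tame
  have tA' := hA'.tame
  have tM := hM.tame
  have tE := hE.tame
  -- A′ = (A∘𝕄)∘A′
  have h1 : A' = comp (comp A M) A' := by
    calc A' = comp E A' := hEA'.symm
      _ = comp (comp (comp A M) E) A' := by rw [hAME]
      _ = comp (comp A M) (comp E A') := (comp_assoc_tame (spr_comp hA hM).tame tE tA').symm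
      _ = comp (comp A M) A' := by rw [hEA']
  -- A = (A∘𝕄)∘A′
  have h2 : A = comp (comp A M) A' := by
    calc A = comp A E := hAE.symm
      _ = comp A (comp (comp E M) A') := by rw [hEMA']
      _ = comp (comp A (comp E M)) A' := comp_assoc_tame tA (spr_comp hE hM).tame tA'
      _ = comp (comp (comp A E) M) A' := by rw [comp_assoc_tame tA tE tM]
      _ = comp (comp A M) A' := by rw [hAE]
  rw [h2, ← h1]

end Unique

/-! ## §2 The consequence for row D1's charts: the bm chart inverts the (0.4)-bordered spread only if it IS `GcombSh` -/

section Charts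

variable {Lc : ℕ} [NeZero Lc]

/-- [folklore] **THE RECORD's PAIRING** (P2 restated): the (III′)∕(III″) literal's chart `GcombSh Lc j` is the relative inverse, on the rooted comb slice `axEc ρ_c`, of the legged
spread bordered by the (0.4)-SYMMETRISED rows `bhKStepSh 3 Lc (Dsh Lc) j`. -/
theorem relInv_record_pair (j : ℕ) :
    RelInv (GcombSh (d := 3) Lc j) (bhKStepSh 3 Lc (Dsh Lc) j) (axEc (ctr (3 + 1) Lc) Lc) :=
  relInv_coDressKAt_Gsym_bhKStepSh j

/-- [folklore] **THE ROOTED PAIRING** (an2 g15's chain restated): the block-mean chart `coDressKBmAt ρ_c Lc (KInvStep Lc j)` is the relative inverse, on the SAME slice, of the spread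
bordered by the ROOTED rows `bhKStepAt 3 ρ_c Lc j`. -/
theorem relInv_rooted_pair (j : ℕ) :
    RelInv (coDressKBmAt (ctr (3 + 1) Lc) Lc (KInvStep (d := 3) Lc j)) (bhKStepAt 3 (ctr (3 + 1) Lc) Lc j) (axEc (ctr (3 + 1) Lc) Lc) :=
  relInv_coDressKBmAt_KInvStep_bhKStepAt (d := 3) (ctrOff_mem_box (d := 3 + 1) (one_le_of_neZero Lc)) j

/-- [folklore] **E-AN2-89-2 BY KERNEL: the bm chart inverts the (0.4)-bordered spread on the comb slice ONLY IF it IS the record's chart.**  `Odd Lc` (P2's standing parity).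
So «the (0.4) tables of record on the bm chart» is not a re-chart of the record: either the charts coincide (they do not: PRESTAB's Δ_chart by value, P2's K0–K5 by name) or the
pairing is not a relative-inverse pairing at all. -/
theorem coDressKBmAt_eq_GcombSh_of_relInv_sym (hLc : Odd Lc) (j : ℕ)
    (h : RelInv (coDressKBmAt (ctr (3 + 1) Lc) Lc (KInvStep (d := 3) Lc j)) (bhKStepSh 3 Lc (Dsh Lc) j) (axEc (ctr (3 + 1) Lc) Lc)) :
    coDressKBmAt (ctr (3 + 1) Lc) Lc (KInvStep (d := 3) Lc j) = GcombSh Lc j :=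
  relInv_unique (spr_coDressKBmAt (one_le_of_neZero Lc) (ctrOff_mem_box (d := 3 + 1) (one_le_of_neZero Lc)) (spr_KInvStep j)) (spr_GcombSh j)
    (spr_bhKStepSh (spr_Dsh hLc.pos) j) (spr_axEc _ _) h (relInv_record_pair j)

end Charts

end Summit.QuantumFields.BalabanUV.Beta.RelInvUnique

end
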